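import Summits.ABC.IUTFork.Cor312GlueReglue
import Summits.ABC.IUTFork.Cor312MultiradTwist
import HarnessLib

/-!
# [IUTchIII] Cor. 3.12 — PRINT'S HULL-REGLUING IS FREE: replacing the (Ind3)-family at a packet by the
# holomorphic hull of its indeterminacy orbit changes neither `−|log(Θ)|` nor the typed Statement, and makes
# the (Ind3)-region admissible there by construction

PROOF-ONLY support piece of the abc-iut cell (seat abc-iut-w5-d060, WAVE-5; the positive complement of
p416677 `Cor312ThetaRegion3UnionNotAdm`, answering the census «STRONGER-THAN-PRINT feature of the typed
`BridgeHyps`» (abc-iut-w5-d155 on p416677, HOME/STATUS 2026-08-26T01:50Z); announced 02:04Z with first refusal to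
abc-iut-w5-d177 / abc-iut-c312-13 / abc-iut-c312-5 / abc-iut-c312-3). TAKES NO SIDE on [IUTchIII] Cor. 3.12.

p416677 shows that the typed bridge hypothesis `BridgeHyps.image_adm` (abc-iut-c312-6) — which asks the
(Ind3)-UNION `P.thetaRegion3 = ⋃_m P.thetaRegion m` ITSELF to be admissible — excludes `m`-varying,
coordinate-separated Θ-Kummer images, whereas the printed proof (p. 174 l. 50 – p. 175 l. 1) only ever forms
`^{n,∘}𝒰_{j,v_ℚ}` := the holomorphic HULL of the union of the (Ind1),(Ind2)-translates of that union, which is a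
hull-set `λ·𝒪` and hence admissible by construction. THIS FILE proves that passing to print's object costs nothing:

* §1 `HullFrame.image_hull_eq_of_mapsHul` — for ANY hull frame `F` (c312-7's `Cor312.HullFrame`) and any
  bijection `φ` of the carrier mapping hull-sets to hull-sets in both directions, `φ '' F.hull U = F.hull (φ '' U)`
  for EVERY subset `U` (bounded case: the two intersection families correspond; unbounded case: both hulls are
  everything; boundedness of `φ '' U` is DERIVED from `exists_hul`).
* §2 `Setting.image_thetaHull_eq_of_mapsHul` — if every indeterminacy `Φ ∈ indGroup S` maps hull-sets of the
  frame at `(j, v_ℚ)` to hull-sets, the packet hull `^{n,∘}𝒰_{j,v_ℚ}` (`P.thetaHull j vQ`) is (Ind1),(Ind2)-STABLE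
  (abc-iut-c312-13's orbit lemma `image_sUnion_possibleImages` + §1).
* §3 at a label packet `(labelSucc i₀, v_ℚ⁰)` where `P.HullDefined` holds and hull-sets admit hulls, RE-GLUE the
  Θ-side by print's object `R♮ := P.thetaHull` (abc-iut-w5-d177's `Setting.reglue`): the local Θ-volumes are
  unchanged at EVERY packet (`reglueHull_thetaLocal`), hence so are `ThetaFinite`, `−|log(Θ)|`, and the typed
  Statement (`reglueHull_thetaFinite_iff`, `reglueHull_negLogTheta`, **`reglueHull_statement_iff`**), while the
  re-glued (Ind3)-region at that packet IS the hull-set `^{n,∘}𝒰` and is therefore ADMISSIBLE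
  (**`adm_thetaRegion3_reglueHull`** — the residual `hθ` of abc-iut-c312-5's `bridgeHyps_of_summands` /
  `Real.bridgeHyps_DH` holds there BY CONSTRUCTION), and `BridgeHyps` is transported (`bridgeHyps_reglueHull`,
  abc-iut-w5-d177's `reglue_bridgeHyps` by name).

Reading (neutral): bracket with p416677 — the stronger-than-print feature of the typed premise set never changes
the adjudicated inequality: whatever the `m`-variation of the Θ-Kummer images, the print-style hull re-gluing at
a packet preserves `P.Statement` and restores `hθ` there, PROVIDED the indeterminacies act by hull-frame
automorphisms (they do in the intended models: capsule permutations, `{±1}` and unit isometries map the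
polydiscs `λ·𝒪_L` to polydiscs — a hypothesis kept EXPLICIT here, discharged for no instance). Pure
bookkeeping over the frozen `Cor312.Setting`; NO definition, NO `Prop` fact; nothing of [IUTchIII] asserted.
[claim: Mochizuki2012, status: disputed] for the Corollary's vocabulary only.
-/

noncomputable section

open Set

namespace Summit.ABC.IUTFork.Cor312

/-! ## 1. Hull frames: a hull-set-preserving bijection commutes with the hull -/

namespace HullFrame

variable {X : Type} (F : HullFrame X)

/-- **A bijection mapping hull-sets to hull-sets (both ways) commutes with the holomorphic hull**:
`φ '' hull U = hull (φ '' U)` for every `U` ([IUTchIII] Rmk. 3.9.5 (i): the hull is "the smallest `λ·𝒪`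
containing `U`", resp. everything for non-relatively-compact `U`; both descriptions are transported by `φ`).
[folklore] -/
theorem image_hull_eq_of_mapsHul (φ : X ≃ X) (hφ : ∀ H ∈ F.Hul, φ '' H ∈ F.Hul)
    (hφ' : ∀ H ∈ F.Hul, φ.symm '' H ∈ F.Hul) (U : Set X) :
    φ '' F.hull U = F.hull (φ '' U) := by
  classical
  by_cases hb : F.IsBounded U
  · -- `φ '' U` is bounded as well: it lies in the hull-set `φ '' H₀`
    obtain ⟨H₀, hH₀, hUH₀⟩ := F.exists_hul U hb
    have hb' : F.IsBounded (φ '' U) :=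
      F.bounded_mono _ _ (Set.image_mono hUH₀) (F.hul_bounded _ (hφ H₀ hH₀))
    unfold HullFrame.hull
    rw [if_pos hb, if_pos hb']
    refine Set.Subset.antisymm ?_ ?_
    · rintro _ ⟨x, hx, rfl⟩
      refine Set.mem_sInter.2 fun H' hH' => ?_
      have hmem : φ.symm '' H' ∈ {H | H ∈ F.Hul ∧ U ⊆ H} :=
        ⟨hφ' H' hH'.1, fun u hu => ⟨φ u, hH'.2 ⟨u, hu, rfl⟩, φ.symm_apply_apply u⟩⟩
      obtain ⟨y, hy, hyx⟩ := Set.mem_sInter.1 hx _ hmem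
      rw [← hyx, φ.apply_symm_apply]
      exact hy
    · intro y hy
      refine ⟨φ.symm y, Set.mem_sInter.2 fun H hH => ?_, φ.apply_symm_apply y⟩
      have hmem : φ '' H ∈ {H' | H' ∈ F.Hul ∧ φ '' U ⊆ H'} := ⟨hφ H hH.1, Set.image_mono hH.2⟩
      obtain ⟨x, hx, hxy⟩ := Set.mem_sInter.1 hy _ hmem
      rw [← hxy, φ.symm_apply_apply]
      exact hx
  · -- both hulls are everything
    have hb' : ¬ F.IsBounded (φ '' U) := fun h => by
      obtain ⟨H₀, hH₀, hUH₀⟩ := F.exists_hul _ h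
      exact hb (F.bounded_mono U (φ.symm '' H₀)
        (fun u hu => ⟨φ u, hUH₀ ⟨u, hu, rfl⟩, φ.symm_apply_apply u⟩) (F.hul_bounded _ (hφ' H₀ hH₀)))
    unfold HullFrame.hull
    rw [if_neg hb, if_neg hb', Set.image_univ_of_surjective φ.surjective]

end HullFrame

/-! ## 2. The packet hull `^{n,∘}𝒰_{j,v_ℚ}` is (Ind1),(Ind2)-stable -/

namespace Setting

open Thm311 Literature.IUT.LogThetaLattice

variable {T : ThetaIndex} {S : Situation T} (P : Setting S)

/-- **`^{n,∘}𝒰_{j,v_ℚ}` is a FIXED POINT of every indeterminacy** that maps hull-sets of the frame at `(j, v_ℚ)`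
to hull-sets: the union of the possible images is (Ind1),(Ind2)-stable (abc-iut-c312-13
`image_sUnion_possibleImages`) and such a `Φ` commutes with the hull (§1). The symmetric hypothesis is free:
`Φ⁻¹ ∈ indGroup S`. [claim: Mochizuki2012, status: disputed] -/
theorem image_thetaHull_eq_of_mapsHul {j : T.Label} {vQ : T.VQ}
    (hHul : ∀ Φ ∈ indGroup S, ∀ H ∈ (P.frame j vQ).Hul, Φ j vQ '' H ∈ (P.frame j vQ).Hul)
    {Φ : S.L.PacketAut} (hΦ : Φ ∈ indGroup S) :
    Φ j vQ '' P.thetaHull j vQ = P.thetaHull j vQ := by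
  have hsymm : ∀ H ∈ (P.frame j vQ).Hul, (Φ j vQ).toEquiv.symm '' H ∈ (P.frame j vQ).Hul := fun H hH => by
    have h := hHul Φ⁻¹ ((indGroup S).inv_mem hΦ) H hH
    rw [coe_inv_apply] at h
    exact h
  have h := (P.frame j vQ).image_hull_eq_of_mapsHul (Φ j vQ).toEquiv
    (fun H hH => hHul Φ hΦ H hH) hsymm (⋃₀ P.possibleImages j vQ)
  unfold thetaHull
  rw [LinearEquiv.coe_toEquiv] at h
  rw [h, P.image_sUnion_possibleImages hΦ]

/-! ## 3. Re-gluing the Θ-side at one packet by print's object `^{n,∘}𝒰` -/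

section ReglueHull

open scoped Classical

variable (i₀ : Fin T.lstar) (vQ₀ : T.VQ)

/-- After re-gluing at `(labelSucc i₀, v_ℚ⁰)` by `R♮ := P.thetaHull`, the (Ind3)-region there IS the packet hull.
[folklore] -/
theorem thetaRegion3_reglueHull :
    (P.reglue (labelSucc i₀) vQ₀ (fun j vQ => P.thetaHull j vQ)).thetaRegion3 (labelSucc i₀) vQ₀ =
      P.thetaHull (labelSucc i₀) vQ₀ :=
  P.reglue_thetaRegion3_self _ _ _

/-- **`hθ` BY CONSTRUCTION after print's hull re-gluing**: if the packet hull is defined at `(labelSucc i₀, v_ℚ⁰)`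
(`HullDefined`: relatively compact and admitting a hull, proof of Cor. 3.12 p. 175 l. 2–4), the re-glued
(Ind3)-region there is the hull-set `^{n,∘}𝒰` and hence ADMISSIBLE (`hul_adm`) — the residual `hθ` of
abc-iut-c312-5's `bridgeHyps_of_summands` / `Real.bridgeHyps_DH` at that packet, whatever the `m`-variation of the
original Θ-Kummer images (contrast p416677 `not_adm_thetaRegion3_of_separated`). [claim: Mochizuki2012, status: disputed] -/
theorem adm_thetaRegion3_reglueHull (hdef : P.HullDefined (labelSucc i₀) vQ₀) :
    (S.D (P.reglue (labelSucc i₀) vQ₀ (fun j vQ => P.thetaHull j vQ)).n).Adm _ vQ₀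
      ((P.reglue (labelSucc i₀) vQ₀ (fun j vQ => P.thetaHull j vQ)).thetaRegion3 (labelSucc i₀) vQ₀) := by
  rw [P.thetaRegion3_reglueHull i₀ vQ₀]
  exact P.thetaHull_adm hdef

variable (hHul : ∀ Φ ∈ indGroup S, ∀ H ∈ (P.frame (labelSucc i₀) vQ₀).Hul,
    Φ (labelSucc i₀) vQ₀ '' H ∈ (P.frame (labelSucc i₀) vQ₀).Hul)
  (hHas : ∀ H ∈ (P.frame (labelSucc i₀) vQ₀).Hul, (P.frame (labelSucc i₀) vQ₀).HasHull H)
  (hdef : P.HullDefined (labelSucc i₀) vQ₀)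

include hHul hHas hdef

/-- **The local Θ-volumes are unchanged at EVERY packet** by the hull re-gluing (at the edited packet both equal
the log-volume of `^{n,∘}𝒰`; elsewhere nothing moved). [claim: Mochizuki2012, status: disputed] -/
theorem reglueHull_thetaLocal (j : T.Label) (vQ : T.VQ) :
    (P.reglue (labelSucc i₀) vQ₀ (fun j vQ => P.thetaHull j vQ)).thetaLocal j vQ = P.thetaLocal j vQ := by
  by_cases h : j = labelSucc i₀ ∧ vQ = vQ₀
  · rw [h.1, h.2]
    have hmem : P.thetaHull (labelSucc i₀) vQ₀ ∈ (P.frame (labelSucc i₀) vQ₀).Hul :=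
      (P.frame (labelSucc i₀) vQ₀).hull_mem_of_hasHull hdef.1 hdef.2
    rw [P.reglue_thetaLocal_self (labelSucc i₀) vQ₀ (fun j vQ => P.thetaHull j vQ)
      (fun Φ hΦ => P.image_thetaHull_eq_of_mapsHul hHul hΦ) hmem (hHas _ hmem)]
    unfold thetaLocal
    rw [if_pos hdef]
  · exact P.reglue_thetaLocal_of_ne _ _ _ h

/-- `ThetaFinite` ("`−|log(Θ)| ∈ ℝ`") is unchanged. [claim: Mochizuki2012, status: disputed] -/
theorem reglueHull_thetaFinite_iff :
    (P.reglue (labelSucc i₀) vQ₀ (fun j vQ => P.thetaHull j vQ)).ThetaFinite ↔ P.ThetaFinite := by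
  unfold ThetaFinite
  simp_rw [P.reglueHull_thetaLocal i₀ vQ₀ hHul hHas hdef]

/-- **`−|log(Θ)|` is unchanged** by print's hull re-gluing at a packet. [claim: Mochizuki2012, status: disputed] -/
theorem reglueHull_negLogTheta :
    (P.reglue (labelSucc i₀) vQ₀ (fun j vQ => P.thetaHull j vQ)).negLogTheta = P.negLogTheta := by
  have hloc := P.reglueHull_thetaLocal i₀ vQ₀ hHul hHas hdef
  have hfin := P.reglueHull_thetaFinite_iff i₀ vQ₀ hHul hHas hdef
  unfold negLogTheta
  by_cases hf : P.ThetaFinite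
  · rw [if_pos hf, if_pos (hfin.2 hf)]
    simp_rw [hloc]
  · rw [if_neg hf, if_neg fun h => hf (hfin.1 h)]

/-- **The typed Statement of Cor. 3.12 is unchanged** by print's hull re-gluing at a packet (and `−|log(q)|`
trivially, `reglue_negLogQ`). [claim: Mochizuki2012, status: disputed] -/
theorem reglueHull_statement_iff :
    (P.reglue (labelSucc i₀) vQ₀ (fun j vQ => P.thetaHull j vQ)).Statement ↔ P.Statement := by
  unfold Statement
  rw [P.reglueHull_negLogTheta i₀ vQ₀ hHul hHas hdef, P.reglue_negLogQ]

/-- The `C_Θ`-form (p. 174 l. 18–19) is unchanged likewise. [claim: Mochizuki2012, status: disputed] -/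
theorem reglueHull_cThetaForm_iff :
    (P.reglue (labelSucc i₀) vQ₀ (fun j vQ => P.thetaHull j vQ)).CThetaForm ↔ P.CThetaForm := by
  unfold CThetaForm absLogQ
  rw [P.reglueHull_negLogTheta i₀ vQ₀ hHul hHas hdef, P.reglue_negLogQ]

end ReglueHull

end Setting

end Summit.ABC.IUTFork.Cor312

/-! ## 4. The bridge hypotheses are transported (abc-iut-w5-d177's `reglue_bridgeHyps`, by name) -/

namespace Summit.ABC.IUTFork.Cor312Vol

open Thm311 Cor312 Cor312.Setting Literature.IUT.LogThetaLattice

variable {T : ThetaIndex} {S : Situation T} {P : Cor312.Setting S}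

/-- `BridgeHyps` survives print's hull re-gluing at a label packet (the new region is an (Ind1),(Ind2)-stable
hull-set admitting a hull). [claim: Mochizuki2012, status: disputed] -/
theorem bridgeHyps_reglueHull (H : BridgeHyps P) (i₀ : Fin T.lstar) (vQ₀ : T.VQ)
    (hHul : ∀ Φ ∈ indGroup S, ∀ H ∈ (P.frame (labelSucc i₀) vQ₀).Hul,
      Φ (labelSucc i₀) vQ₀ '' H ∈ (P.frame (labelSucc i₀) vQ₀).Hul)
    (hHas : ∀ H ∈ (P.frame (labelSucc i₀) vQ₀).Hul, (P.frame (labelSucc i₀) vQ₀).HasHull H) :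
    BridgeHyps (P.reglue (labelSucc i₀) vQ₀ (fun j vQ => P.thetaHull j vQ)) := by
  have hdef : P.HullDefined (labelSucc i₀) vQ₀ := hullDefined_of_finite H i₀ vQ₀
  have hmem : P.thetaHull (labelSucc i₀) vQ₀ ∈ (P.frame (labelSucc i₀) vQ₀).Hul :=
    (P.frame (labelSucc i₀) vQ₀).hull_mem_of_hasHull hdef.1 hdef.2
  exact reglue_bridgeHyps H i₀ vQ₀ (fun j vQ => P.thetaHull j vQ)
    (fun Φ hΦ => P.image_thetaHull_eq_of_mapsHul hHul hΦ) hmem (hHas _ hmem)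

/-- **Summary at a label packet**: under `BridgeHyps P` and hull-frame-automorphic indeterminacies, the
print-style re-glued setting keeps `BridgeHyps`, has the SAME typed Statement, and its (Ind3)-region at the packet
is admissible by construction. [claim: Mochizuki2012, status: disputed] -/
theorem reglueHull_summary (H : BridgeHyps P) (i₀ : Fin T.lstar) (vQ₀ : T.VQ)
    (hHul : ∀ Φ ∈ indGroup S, ∀ H ∈ (P.frame (labelSucc i₀) vQ₀).Hul,
      Φ (labelSucc i₀) vQ₀ '' H ∈ (P.frame (labelSucc i₀) vQ₀).Hul)
    (hHas : ∀ H ∈ (P.frame (labelSucc i₀) vQ₀).Hul, (P.frame (labelSucc i₀) vQ₀).HasHull H) :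
    BridgeHyps (P.reglue (labelSucc i₀) vQ₀ (fun j vQ => P.thetaHull j vQ)) ∧
      ((P.reglue (labelSucc i₀) vQ₀ (fun j vQ => P.thetaHull j vQ)).Statement ↔ P.Statement) ∧
      (S.D P.n).Adm _ vQ₀
        ((P.reglue (labelSucc i₀) vQ₀ (fun j vQ => P.thetaHull j vQ)).thetaRegion3 (labelSucc i₀) vQ₀) :=
  have hdef : P.HullDefined (labelSucc i₀) vQ₀ := hullDefined_of_finite H i₀ vQ₀
  ⟨bridgeHyps_reglueHull H i₀ vQ₀ hHul hHas, P.reglueHull_statement_iff i₀ vQ₀ hHul hHas hdef,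
    P.adm_thetaRegion3_reglueHull i₀ vQ₀ hdef⟩

end Summit.ABC.IUTFork.Cor312Vol

end
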